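/-
Copyright (c) 2026. All rights reserved.
Released under Apache 2.0 license as described in the file LICENSE.
Authors: abc-iut cell, prover seat abc-iut-f-102 (F fact-proving wave, gen 3), over abc-iut-f-101's relative-lift constructor.
-/
import Literature.AnabelianGeometry.AbsoluteAnabelian.LogFrobeniusRealisesOverGenerators
import Literature.AnabelianGeometry.AbsoluteAnabelian.DiagramRelativeFamilies
import HarnessLib

/-!
# [AbsTopIII] Cor 5.5 (i)/(iii)/(v): the relative-lift datum on `D•⊢` realising cores and observables (THEOREM B, toolkit 4/4)

S. Mochizuki, *Topics in absolute anabelian geometry III: global reconstruction algorithms*,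
J. Math. Sci. Univ. Tokyo 22 (2015) 939–1156 [MochizukiAbsTopIII2015]; locators `p.N` = pages of the author's
manuscript (`paper:url-5493eb38cbb7`), read on the page: Cor 5.5 (i) p. 130, (iii) p. 131, (v) pp. 131–133, Def 3.5 (ii)
p. 75 (families of homotopies), (iii) p. 75 (observables, cores), §0 p. 26 (saturated sets).

THEOREM B of the f-102 lineage, assembly step 1: the relative-lift datum (abc-iut-f-101's `RelLifts`,
`DiagramRelativeFamilies.lean`) on the WHOLE diagram `D•⊢` whose generated family of homotopies (`relFamily`) will
realise the cores `ℰ•`, `An•[𝒳]`, `ℰ•` of Cor 5.5 (i) and the observables `S_log⊞_v` of Cor 5.5 (iii) inside ONE family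
(F-0159 `RealisesCor55Families`).  Pivots: the three core vertices and the `𝒩⊞_v`; related pairs: ALL co-verticial pairs
into a core vertex (homotopy = `coreLift A Ξ` of toolkit 2/4), pairs into `𝒩⊞_v` joined by a chain of `ι⊞`-moves
(homotopy = the chain's, well defined by `lchain_hom_eq` of toolkit 1/4 under `IotaSquaresCommute`); the law tying the two
kinds of pivots together (post-composition `𝒩⊞_v → ⋯ → ℰ•`) is the KEY of toolkit 3/4 under the hypotheses that the
`ι⊞_{v,ε}` lie over `Th•[Z]` w.r.t. the over-data `A`, `Ξ` (Pre/Post, stated with `HEq`).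

Hypotheses-as-data (`A`, `Ξ`) and hypotheses (`IotaSquaresCommute`, Pre, Post) only; no claim of the paper is asserted.
Refereed pre-IUT material; nothing here bears on [IUTchIII] Cor. 3.12; typed ≠ proved.
-/

set_option autoImplicit false

universe u

open CategoryTheory Quiver

namespace Literature.AnabelianGeometry.AbsoluteAnabelian

/-! ## Bookkeeping -/

section HEqLemmas

/-- Whiskering on the right respects heterogeneous equality. [folklore] -/
private theorem whiskerRight_heq' {A₁ B B' : Type*} [Category A₁] [Category B] [Category B']
    {F G F' G' : A₁ ⥤ B} (hF : F = F') (hG : G = G') {α : F ⟶ G} {α' : F' ⟶ G'} (h : α ≍ α') {T T' : B ⥤ B'}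
    (hT : T = T') : Functor.whiskerRight α T ≍ Functor.whiskerRight α' T' := by
  subst hF hG hT
  cases h
  rfl

/-- Whiskering on the left respects heterogeneous equality. [folklore] -/
private theorem whiskerLeft_heq' {A' A₁ B : Type*} [Category A'] [Category A₁] [Category B]
    (R : A' ⥤ A₁) {F G F' G' : A₁ ⥤ B} (hF : F = F') (hG : G = G') {α : F ⟶ G} {α' : F' ⟶ G'}
    (h : α ≍ α') : Functor.whiskerLeft R α ≍ Functor.whiskerLeft R α' := by
  subst hF hG
  cases h
  rfl

/-- Iterated right whiskering. [folklore] -/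
private theorem whiskerRight_whiskerRight' {A₁ B B' B'' : Type*} [Category A₁] [Category B] [Category B']
    [Category B''] {F G : A₁ ⥤ B} (α : F ⟶ G) (T : B ⥤ B') (S : B' ⥤ B'') :
    Functor.whiskerRight (Functor.whiskerRight α T) S = Functor.whiskerRight α (T ⋙ S) :=
  NatTrans.ext (funext fun _ => rfl)

/-- `(R ◁ α) ▷ S = R ◁ (α ▷ S)`. [folklore] -/
private theorem whiskerRight_whiskerLeft' {A' A₁ B B' : Type*} [Category A'] [Category A₁] [Category B] [Category B']
    (R : A' ⥤ A₁) {F G : A₁ ⥤ B} (α : F ⟶ G) (S : B ⥤ B') :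
    Functor.whiskerRight (Functor.whiskerLeft R α) S = Functor.whiskerLeft R (Functor.whiskerRight α S) :=
  NatTrans.ext (funext fun _ => rfl)

/-- Right whiskering by the identity functor does nothing. [folklore] -/
private theorem whiskerRight_id_functor' {A₁ B : Type*} [Category A₁] [Category B] {F G : A₁ ⥤ B} (α : F ⟶ G) :
    Functor.whiskerRight α (𝟭 B) = α :=
  NatTrans.ext (funext fun _ => rfl)

/-- Identities of equal objects are heterogeneously equal. [folklore] -/
private theorem heq_id_of_eq' {C : Type*} [Category C] {X Y : C} (h : X = Y) : 𝟙 X ≍ 𝟙 Y := by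
  subst h
  rfl

/-- Composition respects heterogeneous equality. [folklore] -/
private theorem heq_comp' {C : Type*} [Category C] {X Y Z X' Y' Z' : C} {f : X ⟶ Y} {g : Y ⟶ Z} {f' : X' ⟶ Y'}
    {g' : Y' ⟶ Z'} (hX : X = X') (hY : Y = Y') (hZ : Z = Z') (hf : f ≍ f') (hg : g ≍ g') : f ≫ g ≍ f' ≫ g' := by
  subst hX hY hZ
  cases hf
  cases hg
  rfl

/-- A natural transformation whose components are `eqToHom`-conjugates of those of another is heterogeneously equal to it.
[folklore] -/
private theorem heq_of_app_conj {A₁ B : Type*} [Category A₁] [Category B] {F G F' G' : A₁ ⥤ B} (hF : F = F')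
    (hG : G = G') (α : F ⟶ G) (β : F' ⟶ G')
    (h : ∀ x, α.app x = eqToHom (Functor.congr_obj hF x) ≫ β.app x ≫ eqToHom (Functor.congr_obj hG x).symm) :
    α ≍ β := by
  subst hF hG
  simp only [eqToHom_refl, Category.comp_id, Category.id_comp] at h
  exact heq_of_eq (NatTrans.ext (funext h))

end HEqLemmas

namespace DVertex

variable {Vmod : Type u} {isArc : Vmod → Bool}

/-- The row index does not decrease along an arrow of `D•⊢`. [cite: MochizukiAbsTopIII2015, Cor 5.5 p. 130] -/
theorem row_le_of_hom {a b : DVertex Vmod isArc} (e : a ⟶ b) : a.row ≤ b.row := by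
  cases e <;> simp [DVertex.row]

/-- The row index does not decrease along a path of `D•⊢`. [cite: MochizukiAbsTopIII2015, Cor 5.5 p. 130] -/
theorem row_le_of_path {a b : DVertex Vmod isArc} (p : Path a b) : a.row ≤ b.row := by
  induction p with
  | nil => exact le_rfl
  | cons p e ih => exact ih.trans (row_le_of_hom e)

end DVertex

namespace LogFrobeniusSetting

variable {Vmod : Type u} {isArc : Vmod → Bool} (L : LogFrobeniusSetting Vmod isArc)

/-! ## Pivots, related pairs, homotopies -/

/-- The pivot vertices: the three core vertices `ℰ•`, `An•[𝒳]`, `ℰ•` of Cor 5.5 (i) and the observation vertices `𝒩⊞_v`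
of Cor 5.5 (iii). [cite: MochizukiAbsTopIII2015, Cor 5.5 (i) p. 130] -/
def IsPivot : DVertex Vmod isArc → Prop
  | .e5 | .an | .e7 | .nplus _ => True
  | _ => False

/-- The related pairs: every co-verticial pair into a core vertex (Def 3.5 (iii): a core relates ALL pairs); a pair into
`𝒩⊞_v` when joined by a chain of `ι⊞`-moves (Cor 5.5 (iii)). [cite: MochizukiAbsTopIII2015, Definition 3.5 (iii) p.75] -/
def PivotRel {a : DVertex Vmod isArc} : {w : DVertex Vmod isArc} → Path a w → Path a w → Prop
  | .nplus v, p, q => Nonempty (DiagramOfCategories.Chain (LGen (isArc := isArc) v) p q)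
  | .e5, _, _ => True
  | .an, _, _ => True
  | .e7, _, _ => True
  | .row1 _, _, _ => False
  | .core, _, _ => False
  | .nv _, _, _ => False
  | .nmonoPlus _, _, _ => False
  | .nmono _, _, _ => False
  | .emono5, _, _ => False
  | .anMono, _, _ => False
  | .emono7, _, _ => False

variable (A : ∀ (v : Vmod) (ν : LogVertex (isArc v)), ν.isPostLog = false → (L.lam v ν ⋙ L.forget v ⋙ L.toE v ≅ L.proj))
  (Ξ : L.log ⋙ L.proj ≅ L.proj)

/-- The homotopy of a related pair: `coreLift A Ξ` into a core vertex, the chain homotopy into `𝒩⊞_v`.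
[cite: MochizukiAbsTopIII2015, Definition 3.5 (ii) p.75] -/
noncomputable def pivotθ {a : DVertex Vmod isArc} : {w : DVertex Vmod isArc} → IsPivot w → {p q : Path a w} →
    PivotRel p q → (L.diagram.pathFunctor p ⟶ L.diagram.pathFunctor q)
  | .nplus v, _, _, _, h => (Classical.choice h).hom (L.lgenHom v)
  | .e5, _, p, q, _ => L.coreLift A Ξ (show IsCoreVertex DVertex.e5 from trivial) p q
  | .an, _, p, q, _ => L.coreLift A Ξ (show IsCoreVertex DVertex.an from trivial) p q
  | .e7, _, p, q, _ => L.coreLift A Ξ (show IsCoreVertex DVertex.e7 from trivial) p q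
  | .row1 _, h, _, _, _ => False.elim h
  | .core, h, _, _, _ => False.elim h
  | .nv _, h, _, _, _ => False.elim h
  | .nmonoPlus _, h, _, _, _ => False.elim h
  | .nmono _, h, _, _, _ => False.elim h
  | .emono5, h, _, _, _ => False.elim h
  | .anMono, h, _, _, _ => False.elim h
  | .emono7, h, _, _, _ => False.elim h

/-! ## Paths between pivots -/

/-- A path from `𝒩⊞_v` to `𝒩⊞_{v'}` is trivial. [cite: MochizukiAbsTopIII2015, Cor 5.5 p. 130] -/
theorem path_nplus_nplus {v v' : Vmod} (t : Path (DVertex.nplus v : DVertex Vmod isArc) (.nplus v')) :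
    v = v' ∧ t ≍ (Path.nil : Path (DVertex.nplus v : DVertex Vmod isArc) (.nplus v)) := by
  cases t with
  | nil => exact ⟨rfl, HEq.rfl⟩
  | cons t e =>
    cases e
    exact absurd (DVertex.row_le_of_path t) (by simp [DVertex.row])

/-- A path from `𝒩⊞_v` to a core vertex factors through `[forget] ∘ [toE]`. [cite: MochizukiAbsTopIII2015, Cor 5.5 p. 130] -/
theorem exists_eq_ftP_comp {v : Vmod} : ∀ {w : DVertex Vmod isArc} (t : Path (DVertex.nplus v : DVertex Vmod isArc) w),
    IsCoreVertex w → ∃ t₁ : Path (DVertex.e5 : DVertex Vmod isArc) w, t = (ftP v).comp t₁ := by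
  intro w t
  induction t with
  | nil => intro h; exact h.elim
  | cons t e ih =>
    intro hw
    cases e with
    | toE v'' =>
      cases t with
      | cons t e' =>
        cases e'
        obtain ⟨rfl, ht⟩ := path_nplus_nplus t
        cases ht
        exact ⟨Path.nil, rfl⟩
    | κAn =>
      obtain ⟨t₁, rfl⟩ := ih trivial
      exact ⟨t₁.cons DEdge.κAn, rfl⟩
    | anToE =>
      obtain ⟨t₁, rfl⟩ := ih trivial
      exact ⟨t₁.cons DEdge.anToE, rfl⟩
    | _ => exact hw.elim


/-! ## The saturation laws of the related pairs (§0 p. 26) -/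

/-- (a) left diagonal. [cite: MochizukiAbsTopIII2015, Section 0 p.26] -/
theorem pivotRel_refl_left {a : DVertex Vmod isArc} :
    ∀ {w : DVertex Vmod isArc} {p q : Path a w}, IsPivot w → PivotRel p q → PivotRel p p
  | .nplus _, p, _, _, _ => ⟨DiagramOfCategories.Chain.nil p⟩
  | .e5, _, _, _, _ => trivial
  | .an, _, _, _, _ => trivial
  | .e7, _, _, _, _ => trivial
  | .row1 _, _, _, h, _ => False.elim h
  | .core, _, _, h, _ => False.elim h
  | .nv _, _, _, h, _ => False.elim h
  | .nmonoPlus _, _, _, h, _ => False.elim h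
  | .nmono _, _, _, h, _ => False.elim h
  | .emono5, _, _, h, _ => False.elim h
  | .anMono, _, _, h, _ => False.elim h
  | .emono7, _, _, h, _ => False.elim h

/-- (a) right diagonal. [cite: MochizukiAbsTopIII2015, Section 0 p.26] -/
theorem pivotRel_refl_right {a : DVertex Vmod isArc} :
    ∀ {w : DVertex Vmod isArc} {p q : Path a w}, IsPivot w → PivotRel p q → PivotRel q q
  | .nplus _, _, q, _, _ => ⟨DiagramOfCategories.Chain.nil q⟩
  | .e5, _, _, _, _ => trivial
  | .an, _, _, _, _ => trivial
  | .e7, _, _, _, _ => trivial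
  | .row1 _, _, _, h, _ => False.elim h
  | .core, _, _, h, _ => False.elim h
  | .nv _, _, _, h, _ => False.elim h
  | .nmonoPlus _, _, _, h, _ => False.elim h
  | .nmono _, _, _, h, _ => False.elim h
  | .emono5, _, _, h, _ => False.elim h
  | .anMono, _, _, h, _ => False.elim h
  | .emono7, _, _, h, _ => False.elim h

/-- (c) transitivity. [cite: MochizukiAbsTopIII2015, Section 0 p.26] -/
theorem pivotRel_trans {a : DVertex Vmod isArc} :
    ∀ {w : DVertex Vmod isArc} {p q r : Path a w}, IsPivot w → PivotRel p q → PivotRel q r → PivotRel p r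
  | .nplus _, _, _, _, _, h₁, h₂ => ⟨h₁.some.append h₂.some⟩
  | .e5, _, _, _, _, _, _ => trivial
  | .an, _, _, _, _, _, _ => trivial
  | .e7, _, _, _, _, _, _ => trivial
  | .row1 _, _, _, _, h, _, _ => False.elim h
  | .core, _, _, _, h, _, _ => False.elim h
  | .nv _, _, _, _, h, _, _ => False.elim h
  | .nmonoPlus _, _, _, _, h, _, _ => False.elim h
  | .nmono _, _, _, _, h, _, _ => False.elim h
  | .emono5, _, _, _, h, _, _ => False.elim h
  | .anMono, _, _, _, h, _, _ => False.elim h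
  | .emono7, _, _, _, h, _, _ => False.elim h

/-- (d) pre-composition. [cite: MochizukiAbsTopIII2015, Section 0 p.26] -/
theorem pivotRel_precomp {c a : DVertex Vmod isArc} (r : Path c a) :
    ∀ {w : DVertex Vmod isArc} {p q : Path a w}, IsPivot w → PivotRel p q → PivotRel (r.comp p) (r.comp q)
  | .nplus _, _, _, _, h => ⟨h.some.shift r⟩
  | .e5, _, _, _, _ => trivial
  | .an, _, _, _, _ => trivial
  | .e7, _, _, _, _ => trivial
  | .row1 _, _, _, h, _ => False.elim h
  | .core, _, _, h, _ => False.elim h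
  | .nv _, _, _, h, _ => False.elim h
  | .nmonoPlus _, _, _, h, _ => False.elim h
  | .nmono _, _, _, h, _ => False.elim h
  | .emono5, _, _, h, _ => False.elim h
  | .anMono, _, _, h, _ => False.elim h
  | .emono7, _, _, h, _ => False.elim h

/-- (e) post-composition between pivots (a path between two pivots either ends at a core vertex, where every pair is
related, or is the trivial path at `𝒩⊞_v`). [cite: MochizukiAbsTopIII2015, Section 0 p.26] -/
theorem pivotRel_postcomp {a w w' : DVertex Vmod isArc} {p q : Path a w} (t : Path w w') (hw : IsPivot w)
    (hw' : IsPivot w') (h : PivotRel p q) : PivotRel (p.comp t) (q.comp t) := by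
  cases w' with
  | e5 => trivial
  | an => trivial
  | e7 => trivial
  | nplus v' =>
    cases w with
    | nplus v =>
      obtain ⟨rfl, ht⟩ := path_nplus_nplus t
      cases ht
      exact h
    | e5 => exact absurd (DVertex.row_le_of_path t) (by simp [DVertex.row])
    | an => exact absurd (DVertex.row_le_of_path t) (by simp [DVertex.row])
    | e7 => exact absurd (DVertex.row_le_of_path t) (by simp [DVertex.row])
    | row1 _ => exact hw.elim
    | core => exact hw.elim
    | nv _ => exact hw.elim
    | nmonoPlus _ => exact hw.elim
    | nmono _ => exact hw.elim
    | emono5 => exact hw.elim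
    | anMono => exact hw.elim
    | emono7 => exact hw.elim
  | row1 _ => exact hw'.elim
  | core => exact hw'.elim
  | nv _ => exact hw'.elim
  | nmonoPlus _ => exact hw'.elim
  | nmono _ => exact hw'.elim
  | emono5 => exact hw'.elim
  | anMono => exact hw'.elim
  | emono7 => exact hw'.elim

/-! ## The homotopy laws (Def 3.5 (ii)) -/

section Laws

variable (hsq : ∀ v, L.IotaSquaresCommute v)
include hsq

/-- identity on the diagonal. [cite: MochizukiAbsTopIII2015, Definition 3.5 (ii) p.75] -/
theorem pivotθ_self {a : DVertex Vmod isArc} :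
    ∀ {w : DVertex Vmod isArc} (hw : IsPivot w) {p : Path a w} (h : PivotRel p p), L.pivotθ A Ξ hw h = 𝟙 _
  | .nplus v, _, p, h => (L.lchain_hom_eq v (hsq v) (Classical.choice h) (.nil p)).trans
      (DiagramOfCategories.Chain.hom_nil _ p)
  | .e5, _, p, _ => L.coreLift_self A Ξ _ p
  | .an, _, p, _ => L.coreLift_self A Ξ _ p
  | .e7, _, p, _ => L.coreLift_self A Ξ _ p
  | .row1 _, h, _, _ => False.elim h
  | .core, h, _, _ => False.elim h
  | .nv _, h, _, _ => False.elim h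
  | .nmonoPlus _, h, _, _ => False.elim h
  | .nmono _, h, _, _ => False.elim h
  | .emono5, h, _, _ => False.elim h
  | .anMono, h, _, _ => False.elim h
  | .emono7, h, _, _ => False.elim h

/-- composition. [cite: MochizukiAbsTopIII2015, Definition 3.5 (ii) p.75] -/
theorem pivotθ_trans {a : DVertex Vmod isArc} :
    ∀ {w : DVertex Vmod isArc} (hw : IsPivot w) {p q r : Path a w} (h₁ : PivotRel p q) (h₂ : PivotRel q r)
      (h₃ : PivotRel p r), L.pivotθ A Ξ hw h₁ ≫ L.pivotθ A Ξ hw h₂ = L.pivotθ A Ξ hw h₃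
  | .nplus v, _, _, _, _, h₁, h₂, h₃ => by
    show (Classical.choice h₁).hom (L.lgenHom v) ≫ (Classical.choice h₂).hom (L.lgenHom v) =
      (Classical.choice h₃).hom (L.lgenHom v)
    rw [← DiagramOfCategories.Chain.hom_append]
    exact L.lchain_hom_eq v (hsq v) _ _
  | .e5, _, p, q, r, _, _, _ => L.coreLift_trans A Ξ _ p q r
  | .an, _, p, q, r, _, _, _ => L.coreLift_trans A Ξ _ p q r
  | .e7, _, p, q, r, _, _, _ => L.coreLift_trans A Ξ _ p q r
  | .row1 _, h, _, _, _, _, _, _ => False.elim h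
  | .core, h, _, _, _, _, _, _ => False.elim h
  | .nv _, h, _, _, _, _, _, _ => False.elim h
  | .nmonoPlus _, h, _, _, _, _, _, _ => False.elim h
  | .nmono _, h, _, _, _, _, _, _ => False.elim h
  | .emono5, h, _, _, _, _, _, _ => False.elim h
  | .anMono, h, _, _, _, _, _, _ => False.elim h
  | .emono7, h, _, _, _, _, _, _ => False.elim h

/-- pre-composition (whiskering on the left), heterogeneously. [cite: MochizukiAbsTopIII2015, Definition 3.5 (ii) p.75] -/
theorem pivotθ_precomp_heq {c a : DVertex Vmod isArc} :
    ∀ {w : DVertex Vmod isArc} (hw : IsPivot w) (r : Path c a) {p q : Path a w} (h : PivotRel p q)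
      (h' : PivotRel (r.comp p) (r.comp q)),
      L.pivotθ A Ξ hw h' ≍ Functor.whiskerLeft (L.diagram.pathFunctor r) (L.pivotθ A Ξ hw h)
  | .nplus v, _, r, p, q, h, h' => by
    show (Classical.choice h').hom (L.lgenHom v) ≍
      Functor.whiskerLeft (L.diagram.pathFunctor r) ((Classical.choice h).hom (L.lgenHom v))
    rw [L.lchain_hom_eq v (hsq v) (Classical.choice h') ((Classical.choice h).shift r)]
    exact heq_of_app_conj (L.diagram.pathFunctor_comp r p) (L.diagram.pathFunctor_comp r q) _ _
      (fun x => by rw [DiagramOfCategories.Chain.hom_shift_app]; rfl)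
  | .e5, _, r, p, q, _, _ => L.coreLift_precomp_heq A Ξ _ r p q
  | .an, _, r, p, q, _, _ => L.coreLift_precomp_heq A Ξ _ r p q
  | .e7, _, r, p, q, _, _ => L.coreLift_precomp_heq A Ξ _ r p q
  | .row1 _, h, _, _, _, _, _ => False.elim h
  | .core, h, _, _, _, _, _ => False.elim h
  | .nv _, h, _, _, _, _, _ => False.elim h
  | .nmonoPlus _, h, _, _, _, _, _ => False.elim h
  | .nmono _, h, _, _, _, _, _ => False.elim h
  | .emono5, h, _, _, _, _, _ => False.elim h
  | .anMono, h, _, _, _, _, _ => False.elim h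
  | .emono7, h, _, _, _, _, _ => False.elim h

end Laws

/-! ## Post-composition: from `𝒩⊞_v` to a core vertex (the KEY of toolkit 3/4 by induction on chains) -/

/-- `coreLift` at (propositionally) equal pairs of paths. [folklore] -/
private theorem coreLift_congr_heq {a w : DVertex Vmod isArc} (hw : IsCoreVertex w) {p p' q q' : Path a w}
    (hp : p = p') (hq : q = q') : L.coreLift A Ξ hw p q ≍ L.coreLift A Ξ hw p' q' := by
  subst hp hq
  rfl

/-- `An•[𝒳]` (row 6) is a core vertex. [cite: MochizukiAbsTopIII2015, Cor 5.5 (i) p. 130] -/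
theorem an_isCoreVertex : IsCoreVertex (DVertex.an : DVertex Vmod isArc) := trivial

/-- `ℰ•` (row 7) is a core vertex. [cite: MochizukiAbsTopIII2015, Cor 5.5 (i) p. 130] -/
theorem e7_isCoreVertex : IsCoreVertex (DVertex.e7 : DVertex Vmod isArc) := trivial

/-- `pivotθ` at a core vertex is `coreLift`. [cite: MochizukiAbsTopIII2015, Cor 5.5 (i) p. 130] -/
theorem pivotθ_eq_coreLift {a : DVertex Vmod isArc} :
    ∀ {w : DVertex Vmod isArc} (hwc : IsCoreVertex w) (hw : IsPivot w) {p q : Path a w} (h : PivotRel p q),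
      L.pivotθ A Ξ hw h = L.coreLift A Ξ hwc p q
  | .e5, _, _, _, _, _ => rfl
  | .an, _, _, _, _, _ => rfl
  | .e7, _, _, _, _, _ => rfl
  | .nplus _, h, _, _, _, _ => False.elim h
  | .row1 _, h, _, _, _, _ => False.elim h
  | .core, h, _, _, _, _ => False.elim h
  | .nv _, h, _, _, _, _ => False.elim h
  | .nmonoPlus _, h, _, _, _, _ => False.elim h
  | .nmono _, h, _, _, _, _ => False.elim h
  | .emono5, h, _, _, _, _ => False.elim h
  | .anMono, h, _, _, _, _ => False.elim h
  | .emono7, h, _, _, _, _ => False.elim h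

section Post

variable (v : Vmod)
  (hpre : ∀ (ν₁ ν₂ : LogVertex (isArc v)) (ε : LogEdge (isArc v) ν₁ ν₂) (h₁ : ν₁.isPostLog = false)
    (h₂ : ν₂.isPostLog = false) (X₀ : L.X), (L.toE v).map ((L.forget v).map ((L.iota v ε).app X₀)) ≍
    ((A v ν₁ h₁).hom.app X₀ ≫ (A v ν₂ h₂).inv.app X₀))
  (hpost : ∀ (ν₁ ν₂ : LogVertex (isArc v)) (ε : LogEdge (isArc v) ν₁ ν₂) (_ : ν₁.isPostLog = true)
    (h₂ : ν₂.isPostLog = false) (hsl : (LogVertex.spaceLink (isArc v)).isPostLog = false) (X₀ : L.X),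
    (L.toE v).map ((L.forget v).map ((L.iota v ε).app X₀)) ≍
    ((A v _ hsl).hom.app (L.log.obj X₀) ≫ Ξ.hom.app X₀ ≫ (A v ν₂ h₂).inv.app X₀))
include hpre hpost

/-- The KEY of toolkit 3/4 pushed along a further path `t₁ : ℰ• ⟶ w'` into another core vertex: on a whiskered generator pair
the core homotopy is the whiskered generator homotopy. [cite: MochizukiAbsTopIII2015, Cor 5.5 (iii) p. 131] -/
theorem coreLift_lgen_comp {w' : DVertex Vmod isArc} (hw' : IsCoreVertex w') (t₁ : Path (DVertex.e5 : DVertex Vmod isArc) w')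
    {c : DVertex Vmod isArc} {g g' : Path c (DVertex.nplus v)} (s : LGen (isArc := isArc) v g g') :
    L.coreLift A Ξ hw' (g.comp ((ftP v).comp t₁)) (g'.comp ((ftP v).comp t₁)) ≍
      Functor.whiskerRight (L.lgenHom v s) (L.diagram.pathFunctor ((ftP v).comp t₁)) := by
  refine (L.coreLift_congr_heq A Ξ hw' (Path.comp_assoc _ _ _).symm (Path.comp_assoc _ _ _).symm).trans ?_
  refine (L.coreLift_postcomp_heq A Ξ e5_isCoreVertex hw' _ _ t₁).trans ?_
  rw [L.coreLift_lgen v A Ξ hpre hpost s]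
  refine (whiskerRight_heq' (α' := Functor.whiskerRight (L.lgenHom v s) (L.diagram.pathFunctor (ftP v)))
    (L.diagram.pathFunctor_comp g (ftP v)) (L.diagram.pathFunctor_comp g' (ftP v))
    (DiagramOfCategories.HomotopyFamily.heq_eqToHom_comp_comp_eqToHom _ _ _) (rfl : L.diagram.pathFunctor t₁ = _)).trans
    ?_
  rw [whiskerRight_whiskerRight']
  exact whiskerRight_heq' rfl rfl HEq.rfl (L.diagram.pathFunctor_comp _ _).symm

/-- **The core homotopy on a post-composed chain-related pair is the whiskered chain homotopy** (induction on the chain;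
one move = the KEY, transported along a common prefix by `coreLift_precomp_heq` and composed by `coreLift_trans`).
[cite: MochizukiAbsTopIII2015, Cor 5.5 (iii) p. 131] -/
theorem coreLift_chain_comp {w' : DVertex Vmod isArc} (hw' : IsCoreVertex w') (t₁ : Path (DVertex.e5 : DVertex Vmod isArc) w')
    {a : DVertex Vmod isArc} {p q : Path a (DVertex.nplus v)}
    (c : DiagramOfCategories.Chain (LGen (isArc := isArc) v) p q) :
    L.coreLift A Ξ hw' (p.comp ((ftP v).comp t₁)) (q.comp ((ftP v).comp t₁)) ≍
      Functor.whiskerRight (c.hom (L.lgenHom v)) (L.diagram.pathFunctor ((ftP v).comp t₁)) := by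
  induction c with
  | nil p =>
    rw [L.coreLift_self, DiagramOfCategories.Chain.hom_nil, Functor.whiskerRight_id']
    exact heq_id_of_eq' (L.diagram.pathFunctor_comp _ _)
  | cons m rest ih =>
    obtain ⟨c₀, r, g, g', s, hp, hp'⟩ := m
    subst hp hp'
    rw [DiagramOfCategories.Chain.hom_cons, Functor.whiskerRight_comp,
      ← L.coreLift_trans A Ξ hw' _ ((r.comp g').comp ((ftP v).comp t₁)) _]
    refine heq_comp' (L.diagram.pathFunctor_comp _ _) (L.diagram.pathFunctor_comp _ _)
      (L.diagram.pathFunctor_comp _ _) ?_ ih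
    -- one move: transport the KEY along the common prefix `r`
    refine (L.coreLift_congr_heq A Ξ hw' (Path.comp_assoc _ _ _) (Path.comp_assoc _ _ _)).trans ?_
    refine (L.coreLift_precomp_heq A Ξ hw' r _ _).trans ?_
    refine (whiskerLeft_heq' (L.diagram.pathFunctor r) (L.diagram.pathFunctor_comp _ _) (L.diagram.pathFunctor_comp _ _)
      (L.coreLift_lgen_comp A Ξ v hpre hpost hw' t₁ s)).trans ?_
    rw [← whiskerRight_whiskerLeft']
    exact whiskerRight_heq' (L.diagram.pathFunctor_comp r g).symm (L.diagram.pathFunctor_comp r g').symm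
      (DiagramOfCategories.HomotopyFamily.heq_eqToHom_comp_comp_eqToHom _ _ _).symm rfl

end Post

section Assembly

variable (hsq : ∀ v, L.IotaSquaresCommute v)
  (hpre : ∀ (v : Vmod) (ν₁ ν₂ : LogVertex (isArc v)) (ε : LogEdge (isArc v) ν₁ ν₂) (h₁ : ν₁.isPostLog = false)
    (h₂ : ν₂.isPostLog = false) (X₀ : L.X), (L.toE v).map ((L.forget v).map ((L.iota v ε).app X₀)) ≍
    ((A v ν₁ h₁).hom.app X₀ ≫ (A v ν₂ h₂).inv.app X₀))
  (hpost : ∀ (v : Vmod) (ν₁ ν₂ : LogVertex (isArc v)) (ε : LogEdge (isArc v) ν₁ ν₂) (_ : ν₁.isPostLog = true)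
    (h₂ : ν₂.isPostLog = false) (hsl : (LogVertex.spaceLink (isArc v)).isPostLog = false) (X₀ : L.X),
    (L.toE v).map ((L.forget v).map ((L.iota v ε).app X₀)) ≍
    ((A v _ hsl).hom.app (L.log.obj X₀) ≫ Ξ.hom.app X₀ ≫ (A v ν₂ h₂).inv.app X₀))

section PostCore

include hpre hpost

/-- post-composition from `𝒩⊞_v` or a core vertex into a core vertex, heterogeneously.
[cite: MochizukiAbsTopIII2015, Definition 3.5 (ii) p.75] -/
theorem pivotθ_postcomp_core {a w w' : DVertex Vmod isArc} (hw : IsPivot w) (hw' : IsPivot w') (hwc' : IsCoreVertex w')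
    {p q : Path a w} (t : Path w w') (h : PivotRel p q) (h' : PivotRel (p.comp t) (q.comp t)) :
    L.pivotθ A Ξ hw' h' ≍ Functor.whiskerRight (L.pivotθ A Ξ hw h) (L.diagram.pathFunctor t) := by
  rw [L.pivotθ_eq_coreLift A Ξ hwc' hw' h']
  cases w with
  | nplus v₀ =>
    obtain ⟨t₁, rfl⟩ := exists_eq_ftP_comp t hwc'
    exact L.coreLift_chain_comp A Ξ v₀ (hpre v₀) (hpost v₀) hwc' t₁ (Classical.choice h)
  | e5 =>
    rw [L.pivotθ_eq_coreLift A Ξ e5_isCoreVertex hw h]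
    exact L.coreLift_postcomp_heq A Ξ e5_isCoreVertex hwc' p q t
  | an =>
    rw [L.pivotθ_eq_coreLift A Ξ an_isCoreVertex hw h]
    exact L.coreLift_postcomp_heq A Ξ an_isCoreVertex hwc' p q t
  | e7 =>
    rw [L.pivotθ_eq_coreLift A Ξ e7_isCoreVertex hw h]
    exact L.coreLift_postcomp_heq A Ξ e7_isCoreVertex hwc' p q t
  | row1 _ => exact hw.elim
  | core => exact hw.elim
  | nv _ => exact hw.elim
  | nmonoPlus _ => exact hw.elim
  | nmono _ => exact hw.elim
  | emono5 => exact hw.elim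
  | anMono => exact hw.elim
  | emono7 => exact hw.elim

/-- post-composition (whiskering on the right) between any two pivots, heterogeneously.
[cite: MochizukiAbsTopIII2015, Definition 3.5 (ii) p.75] -/
theorem pivotθ_postcomp_heq {a w w' : DVertex Vmod isArc} (hw : IsPivot w) (hw' : IsPivot w')
    {p q : Path a w} (t : Path w w') (h : PivotRel p q) (h' : PivotRel (p.comp t) (q.comp t)) :
    L.pivotθ A Ξ hw' h' ≍ Functor.whiskerRight (L.pivotθ A Ξ hw h) (L.diagram.pathFunctor t) := by
  cases w' with
  | e5 => exact L.pivotθ_postcomp_core A Ξ hpre hpost hw hw' e5_isCoreVertex t h h'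
  | an => exact L.pivotθ_postcomp_core A Ξ hpre hpost hw hw' an_isCoreVertex t h h'
  | e7 => exact L.pivotθ_postcomp_core A Ξ hpre hpost hw hw' e7_isCoreVertex t h h'
  | nplus v' =>
    cases w with
    | nplus v =>
      obtain ⟨rfl, ht⟩ := path_nplus_nplus t
      cases ht
      exact ((whiskerRight_heq' rfl rfl HEq.rfl (L.diagram.pathFunctor_nil (DVertex.nplus v))).trans
        (heq_of_eq (whiskerRight_id_functor' _))).symm
    | e5 => exact absurd (DVertex.row_le_of_path t) (by simp [DVertex.row])
    | an => exact absurd (DVertex.row_le_of_path t) (by simp [DVertex.row])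
    | e7 => exact absurd (DVertex.row_le_of_path t) (by simp [DVertex.row])
    | row1 _ => exact hw.elim
    | core => exact hw.elim
    | nv _ => exact hw.elim
    | nmonoPlus _ => exact hw.elim
    | nmono _ => exact hw.elim
    | emono5 => exact hw.elim
    | anMono => exact hw.elim
    | emono7 => exact hw.elim
  | row1 _ => exact hw'.elim
  | core => exact hw'.elim
  | nv _ => exact hw'.elim
  | nmonoPlus _ => exact hw'.elim
  | nmono _ => exact hw'.elim
  | emono5 => exact hw'.elim
  | anMono => exact hw'.elim
  | emono7 => exact hw'.elim

end PostCore

/-- **The relative-lift datum of THEOREM B** (abc-iut-f-101's `RelLifts` on `D•⊢`): pivots the core vertices and the `𝒩⊞_v`,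
related pairs ALL pairs into a core vertex and the `ι⊞`-chain-related pairs into `𝒩⊞_v`, homotopies `coreLift A Ξ` and the
chain homotopies — well defined and coherent under `IotaSquaresCommute` (coherence of chains) and the hypotheses that the
`ι⊞_{v,ε}` lie over `Th•[Z]` w.r.t. `A`, `Ξ` (compatibility of the two kinds of pivots).  Its generated family
`relFamily` is the family of homotopies on `D•⊢` realising Cor 5.5 (i)/(iii) (next file).
[cite: MochizukiAbsTopIII2015, Cor 5.5 (iii) p. 131] -/
noncomputable def realisesRelLifts : L.diagram.RelLifts where
  W := IsPivot
  Rel := fun _ _ p q => PivotRel p q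
  θ := fun _ _ hw _ _ h => L.pivotθ A Ξ hw h
  rel_refl_left := fun _ _ _ _ hw h => pivotRel_refl_left hw h
  rel_refl_right := fun _ _ _ _ hw h => pivotRel_refl_right hw h
  rel_trans := fun _ _ _ _ _ hw h₁ h₂ => pivotRel_trans hw h₁ h₂
  rel_precomp := fun _ _ _ r _ _ hw h => pivotRel_precomp r hw h
  rel_postcomp := fun _ _ _ _ _ t hw hw' h => pivotRel_postcomp t hw hw' h
  θ_self := fun _ _ hw _ h => L.pivotθ_self A Ξ hsq hw h
  θ_trans := fun _ _ hw _ _ _ h₁ h₂ h₃ => L.pivotθ_trans A Ξ hsq hw h₁ h₂ h₃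
  θ_precomp_heq := fun _ _ _ hw r _ _ h h' => L.pivotθ_precomp_heq A Ξ hsq hw r h h'
  θ_postcomp_heq := fun _ _ _ hw hw' _ _ t h h' => L.pivotθ_postcomp_heq A Ξ hpre hpost hw hw' t h h'

/-- The pivots of the datum. [cite: MochizukiAbsTopIII2015, Cor 5.5 (i) p. 130] -/
theorem realisesRelLifts_W (w : DVertex Vmod isArc) : (L.realisesRelLifts A Ξ hsq hpre hpost).W w ↔ IsPivot w := Iff.rfl

/-- The related pairs of the datum. [cite: MochizukiAbsTopIII2015, Definition 3.5 (iii) p.75] -/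
theorem realisesRelLifts_rel {a w : DVertex Vmod isArc} (p q : Path a w) :
    (L.realisesRelLifts A Ξ hsq hpre hpost).Rel p q ↔ PivotRel p q := Iff.rfl

/-- The homotopies of the datum. [cite: MochizukiAbsTopIII2015, Definition 3.5 (ii) p.75] -/
theorem realisesRelLifts_θ {a w : DVertex Vmod isArc} (hw : IsPivot w) {p q : Path a w} (h : PivotRel p q) :
    (L.realisesRelLifts A Ξ hsq hpre hpost).θ hw h = L.pivotθ A Ξ hw h := rfl

end Assembly


end LogFrobeniusSetting

end Literature.AnabelianGeometry.AbsoluteAnabelian
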